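import Summits.ResolutionOfSingularities.ResolutionOfSingularities.Theorems.PAlterationPicoverOfDegP
import Summits.ResolutionOfSingularities.ResolutionOfSingularities.Theorems.PAlterationPicoverDegPOfPicover
import Summits.ResolutionOfSingularities.ResolutionOfSingularities.Theorems.PAlterationPicoverLocalModelOfDegP

/-!
# Crux `Picover` (stmt-ResolutionOfSingularities-0554): equivalence with its degree-`p` residue, and the rank-5 local model

Route `ResolutionOfSingularities/pAlteration`, line `degree-p-tower`. Packaging of the landed sub-goals:
`Picover ⟺ residue` (`picover_of_picoverDegP`, `picoverDegP_of_picover`) and `Picover → PicoverLocalModel`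
(rank 2 ⟹ rank 5 BY NAME, through the residue: `picoverLocalModel_of_picoverDegP`).
-/

set_option linter.dupNamespace false -- mandated namespace of this single-conjunct summit

open CategoryTheory AlgebraicGeometry TopologicalSpace
open Literature.AlgebraicGeometry.Resolution Literature.AlgebraicGeometry.Motives
open Summit.ResolutionOfSingularities.ResolutionOfSingularities.Theorems.Picover

namespace Summit.ResolutionOfSingularities.ResolutionOfSingularities.Theorems.Picover.IffDegP

/-- **The crux `Picover` is equivalent to its degree-`p` residue** (registered sub-goal
`picover_iff_picoverDegP`): resolution of finite radicial covers of regular varieties ⟺ resolution of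
the normalizations of regular varieties in degree-`p` purely inseparable extensions of their function
fields (Temkin 2013, Rem. 1.3.5 (ii)-(iii), made formal). [cite: Temkin2013, Rem. 1.3.5 (ii)-(iii)] -/
theorem picover_iff_picoverDegP : Summit.ResolutionOfSingularities.ResolutionOfSingularities.Theses.PAlteration.Picover ↔ (∀ (p : ℕ), p.Prime → ∀ (k : Type) [Field k] [CharP k p] (W : Scheme.{0}) [IsIntegral W] (f : W ⟶ Spec (.of k)) (L : Type) [Field L] [Algebra W.functionField L], IsSeparated f → LocallyOfFiniteType f → QuasiCompact f → Scheme.IsRegular W → IsPurelyInseparable W.functionField L → Module.finrank W.functionField L = p → Scheme.HasResolution (normalizationIn W L)) :=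
  ⟨DegPOfPicover.picoverDegP_of_picover, OfDegP.picover_of_picoverDegP⟩

/-- **Rank 2 implies rank 5 by name**: the crux `Picover` implies the route's local model
`PicoverLocalModel` (stmt-ResolutionOfSingularities-0557), through the residue (registered sub-goal
`picoverLocalModel_of_picover`). [folklore] -/
theorem picoverLocalModel_of_picover : Summit.ResolutionOfSingularities.ResolutionOfSingularities.Theses.PAlteration.Picover → Summit.ResolutionOfSingularities.ResolutionOfSingularities.Theses.PAlteration.PicoverLocalModel :=
  fun h => LocalModelOfDegP.picoverLocalModel_of_picoverDegP (DegPOfPicover.picoverDegP_of_picover h)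

end Summit.ResolutionOfSingularities.ResolutionOfSingularities.Theorems.Picover.IffDegP
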